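import Literature.Computability.QuantumComplexity.AaronsonAmbainisThm23
import Literature.Computability.QuantumComplexity.AaronsonAmbainisThm23Queries
import Literature.Computability.Cryptography.QubitRegisterCliffordTProofs
import Literature.Computability.Complexity.CountingHierarchyProofs
import Literature.Computability.Complexity.CountingProofs
import HarnessLib

/-!
# Aaronson–Ambainis 2014, Thm. 23: claim (apx) reduced to the polynomial-time implementability of the simulation

Claim (apx) of the proof of Aaronson–Ambainis' Thm. 23 (arXiv:0911.0996v3, p. 14): under
Conjecture 6 and `P = P^{#P}`, for every uniform quantum oracle machine there is a
polynomial-TIME classical oracle machine `C` whose thresholded output is wrong (under the `BQP`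
promise) only on a set of oracles of measure `< 1/n³` (the statement is spelled out as the
CONCLUSION of the two theorems below and consumed, as an explicit hypothesis, by
`Literature.Barriers.QuantumAdvantage.aaronsonAmbainis2014_thm7iii_of_apx`,
`Barriers/QuantumAdvantage/RandomOracleMethodThm23.lean`; D-0026: it is an internal claim of the
proof of Thm. 23 = Thm. 7 (iii), not a separately citable result, so it is NOT a named fact). The
printed proof has two ingredients:

1. the algorithm of Thm. 21 run on the acceptance polynomial `p_x` (Lemma 20), with `poly(n)`
   QUERIES and error probability `< 1/n³` over the random oracle — in the tree:
   `simTreeOn c C₀ F x` with `measure_simTreeOn_threshold_lt` (`AaronsonAmbainisThm23Queries.lean`,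
   on `OraclePolynomialMethod.lean`, `AaronsonAmbainisProofs.lean`/`AaronsonAmbainisSimTreeBounds.lean`);
2. "The key point is that we can implement `C` using not only `poly(n)` queries to `A`, but also
   `poly(n)` computation steps" (coefficients `α_M` in `P^{#P}` by Bernstein–Vazirani, `E[p_j]`
   in `P^{#P}`, `Vr`/`Inf` in the second level of `CH`, finding `i` in the third, and `CH`
   collapses to `P` under `P = P^{#P}`) — NOT in the tree (no machine-level evaluation of
   Clifford+T path sums with oracle gates; cf. the open counting obligation isolated in
   `BQPRelSubsetAWPPRel.lean` and the named machine facts of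
   `Barriers/QuantumAdvantage/AaronsonChenSimulation.lean`).

This file proves **(apx) from ingredient 2 stated as an explicit hypothesis** about the trees of
ingredient 1 (`aaronsonAmbainis2014_thm23_apx_of_machines`): if, for the constants `c, C₀` of
Conjecture 6 and under `P = P^{#P}`, every uniform family `F` admits a polynomial-time transcript
machine `C` with polynomially bounded rounds and queries such that
`C^A(x) = [ (simTreeOn c C₀ F x)(bits of A) ≥ 1/2 ]` for all oracles `A` and inputs `x` of length
`≥ 1`, then (apx) holds. The trees are DEFINITE algorithms (the queried variable is the least
influential index, `ClassicalSimulation.pickVar_eq_some_iff`; the outputs are the means `E[p_ρ]`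
thresholded at `1/2`), so the hypothesis is a statement about implementing a specific decision
procedure. The hypothesis is a plain `Prop` argument of a proved theorem (D-0026: no named fact);
it is the precise remaining obligation for Thm. 7 (iii)
(`Literature.Barriers.QuantumAdvantage.aaronsonAmbainis2014_thm7iii`, via
`aaronsonAmbainis2014_thm7iii_of_dyadicMachines` of `RandomOracleMethodThm23.lean`) and hence for
the barrier `RandomOracleMethod`. The machine-facing form
`aaronsonAmbainis2014_thm23_apx_of_dyadicMachines` asks for the machines only for DYADIC constants
`C₀ = 2^{-k}` (all thresholds rational; the real constant of `AAConjecture` is rounded down,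
`aaConjectureBody_mono`) — this is the statement to target; and the trees depend on the witness
polynomial `acceptPoly F x` only through the VALUES `p_x` (`ClassicalSimulation.simTree_congr`,
`simTreeOn_eq_of_evalBool`), so an implementation may work with any representation of `p_x`.
For that obligation the tree already has the collapse used in the printed proof: under
`P = P^{#P}` the counting hierarchy is `P` (`CH_eq_P_of_P_eq_PSharpP`, from
`PP_subset_PSharpP_holds` and `CH_eq_P_of_PP_eq_P`), and the assembly of a transcript machine
from a query generator in `FP` and an evaluator in `P` (`AdQuery.adAlg`, `AdaptiveQueries.lean`).

## References

* S. Aaronson, A. Ambainis, *The need for structure in quantum speedups*, Theory Comput. 10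
  (2014), proof of Thm. 23 (arXiv:0911.0996v3, p. 14) [AaronsonAmbainis2014].
* E. Bernstein, U. Vazirani, *Quantum complexity theory*, SIAM J. Comput. 26 (1997), §8
  (`BQP ⊆ P^{#P}`) [BernsteinVazirani1997].
-/

noncomputable section

namespace Literature.Computability.QuantumComplexity

open MeasureTheory _root_.Computability Literature.Computability.Complexity
  Literature.Computability.Complexity.Classes Literature.Computability.Cryptography

/-- **Claim (apx) from the polynomial-time implementability of the simulation trees.** If for
the constants `c, C₀` of Conjecture 6 (hypothesis `H`, the body of `AAConjecture`) and under
`P = P^{#P}` every uniform Clifford+T oracle circuit family `F` has a polynomial-time transcript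
machine computing `A, x ↦ [ (simTreeOn c C₀ F x).eval (oracleBits F x A) ≥ 1/2 ]` within a
polynomial round/query-length budget ("we can implement `C` using … `poly(n)` computation
steps"), then claim (apx) of the proof of Thm. 23 holds (conclusion spelled out: for every
uniform `F` a polynomial-time transcript machine `C` and budget `q` whose answer differs from the
`BQP`-promise bit of `F^A` at an input `x` of length `n ≥ 1` only on a set of oracles of measure
`< 1/n³`): the error event of (apx) is the thresholded-deviation event of
`measure_simTreeOn_threshold_lt`, of measure `< 1/n³`. [cite: AaronsonAmbainis2014, Thm. 23 (proof, p. 14)] -/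
theorem aaronsonAmbainis2014_thm23_apx_of_machines
    (hmach : ∀ (c : ℕ) (C₀ : ℝ), 0 < C₀ →
      (∀ (N d : ℕ) (p : MvPolynomial (Fin N) ℝ) (ε : ℝ), 1 ≤ d → p.totalDegree ≤ d →
        (∀ y, 0 ≤ evalBool p y ∧ evalBool p y ≤ 1) → 0 < ε → ε ≤ boolVariance p →
          ∃ i : Fin N, C₀ * (ε / d) ^ c ≤ influence i p) →
      P = PSharpP → ∀ F : QCircuitFamily cliffordT, F.IsUniform →
        ∃ (C : OracleAlg Bool) (q : Polynomial ℕ), C.IsPolyTime encodingBoolBool ∧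
          (∀ (A : Language Bool) (x : List Bool),
            ∀ y ∈ C.queries (Oracle.ofLanguage A) (q.eval x.length) x, y.length ≤ q.eval x.length) ∧
          ∀ (A : Language Bool) (x : List Bool), 1 ≤ x.length →
            C.run (Oracle.ofLanguage A) (q.eval x.length) x =
              some (decide (1 / 2 ≤ (simTreeOn c C₀ F x).eval (oracleBits F x A)))) :
    AAConjecture → P = PSharpP →
      ∀ F : QCircuitFamily cliffordT, F.IsUniform →
        ∃ (C : OracleAlg Bool) (q : Polynomial ℕ), C.IsPolyTime encodingBoolBool ∧
          (∀ (A : Language Bool) (x : List Bool),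
            ∀ y ∈ C.queries (Oracle.ofLanguage A) (q.eval x.length) x, y.length ≤ q.eval x.length) ∧
          ∀ x : List Bool, 1 ≤ x.length →
            randomOracleMeasure {A : Set (List Bool) |
                (2 / 3 ≤ F.acceptProbOn A x ∧
                    C.run (Oracle.ofLanguage A) (q.eval x.length) x ≠ some true) ∨
                (F.acceptProbOn A x ≤ 1 / 3 ∧
                    C.run (Oracle.ofLanguage A) (q.eval x.length) x ≠ some false)}
              < ENNReal.ofReal (1 / (x.length : ℝ) ^ 3) := by
  intro hAA hP F hF
  obtain ⟨c, C₀, hC₀, H⟩ := hAA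
  obtain ⟨C, q, hpoly, hq, hrun⟩ := hmach c C₀ hC₀ H hP F hF
  refine ⟨C, q, hpoly, hq, fun x hn => ?_⟩
  have hev := measure_simTreeOn_threshold_lt (c := c) (C₀ := C₀) F x hC₀ H
    cliffordT_isUnitary_holds hn
  refine lt_of_le_of_lt (measure_mono fun A hA => ?_) hev
  simp only [Set.mem_setOf_eq] at hA ⊢
  rw [hrun A x hn] at hA
  simpa only [ne_eq, Option.some.injEq] using hA



/-! ### The trees depend on the polynomial only through its values -/

namespace ClassicalSimulation

/-- `pickVar` depends on `p` only through its influences. [folklore] -/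
theorem pickVar_congr {N : ℕ} (w : ℝ) {p p' : MvPolynomial (Fin N) ℝ}
    (h : ∀ i, influence i p = influence i p') : pickVar w p = pickVar w p' := by
  cases hp' : pickVar w p' with
  | none =>
    rw [pickVar_eq_none_iff] at hp' ⊢
    intro i; rw [h i]; exact hp' i
  | some i =>
    rw [pickVar_eq_some_iff] at hp' ⊢
    refine ⟨?_, fun j hj => ?_⟩
    · rw [h i]; exact hp'.1
    · rw [h j]; exact hp'.2 j hj

/-- **The simulation tree depends on `p` only through its values on the cube** (so an
implementation may use ANY representation of the acceptance probabilities `p_x`, not the witness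
polynomial `acceptPoly F x` chosen in `simTreeOn`). [folklore] -/
theorem simTree_congr {N : ℕ} (θ w : ℝ) :
    ∀ (D : ℕ) {p p' : MvPolynomial (Fin N) ℝ}, (∀ x, evalBool p x = evalBool p' x) →
      simTree θ w D p = simTree θ w D p'
  | 0, p, p', h => by
    have hf : evalBool p = evalBool p' := funext h
    simp [simTree, hf]
  | D + 1, p, p', h => by
    have hf : evalBool p = evalBool p' := funext h
    have hv : boolVariance p = boolVariance p' := by unfold boolVariance; rw [hf]
    have hi : ∀ i, influence i p = influence i p' := fun i => by unfold influence; rw [hf]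
    have hr : ∀ (i : Fin N) (b : Bool) (x : Fin N → Bool),
        evalBool (restrictPoly i b p) x = evalBool (restrictPoly i b p') x := by
      intro i b x; rw [evalBool_restrictPoly, evalBool_restrictPoly, h]
    by_cases h1 : boolVariance p ≤ θ
    · rw [simTree_succ_of_le θ w h1, simTree_succ_of_le θ w (hv ▸ h1), hf]
    · have h1' : ¬ boolVariance p' ≤ θ := hv ▸ h1
      cases hp : pickVar w p' with
      | none =>
        rw [simTree_succ_of_none θ w h1 ((pickVar_congr w hi).trans hp),
          simTree_succ_of_none θ w h1' hp, hf]
      | some i =>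
        rw [simTree_succ_of_some θ w h1 ((pickVar_congr w hi).trans hp),
          simTree_succ_of_some θ w h1' hp, simTree_congr θ w D (hr i false),
          simTree_congr θ w D (hr i true)]

end ClassicalSimulation

/-- In particular `simTreeOn` may be computed from any polynomial (or table) with the values
`p_x(oracleOf b)`, `b ∈ {0,1}^M`. [folklore] -/
theorem simTreeOn_eq_of_evalBool {c : ℕ} {C₀ : ℝ} (F : QCircuitFamily cliffordT) (x : List Bool)
    {p' : MvPolynomial (Fin (numOracleBits F x)) ℝ}
    (h : ∀ b, evalBool p' b = F.acceptProbOn (oracleOf F x b) x) :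
    simTreeOn c C₀ F x =
      ClassicalSimulation.simTree ((1 / 10) ^ 2 * thm23Delta x / 2)
        (C₀ * (((1 / 10) ^ 2 * thm23Delta x / 2) / thm23Degree F x) ^ c)
        (Nat.ceil (8 * (thm23Degree F x : ℝ) /
          ((C₀ * (((1 / 10) ^ 2 * thm23Delta x / 2) / thm23Degree F x) ^ c) * thm23Delta x)))
        p' := by
  unfold simTreeOn
  refine ClassicalSimulation.simTree_congr _ _ _ fun b => ?_
  rw [h b, ← oracleBits_oracleOf F x b, evalBool_acceptPoly, oracleBits_oracleOf]

/-! ### Dyadic constants: the machine-facing form of the obligation -/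

/-- **The conjecture's constant may be taken dyadic**: if the body of Conjecture 6 holds with
constants `c, C₀ > 0`, it holds with `c` and `2^{-k}` for every `k` with `2^{-k} ≤ C₀` (the
conclusion `C₀ (ε/d)^c ≤ Inf_i` only weakens). [folklore] -/
theorem aaConjectureBody_mono {c : ℕ} {C₀ C₁ : ℝ} (hle : C₁ ≤ C₀)
    (H : ∀ (N d : ℕ) (p : MvPolynomial (Fin N) ℝ) (ε : ℝ), 1 ≤ d → p.totalDegree ≤ d →
      (∀ y, 0 ≤ evalBool p y ∧ evalBool p y ≤ 1) → 0 < ε → ε ≤ boolVariance p →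
        ∃ i : Fin N, C₀ * (ε / d) ^ c ≤ influence i p) :
    ∀ (N d : ℕ) (p : MvPolynomial (Fin N) ℝ) (ε : ℝ), 1 ≤ d → p.totalDegree ≤ d →
      (∀ y, 0 ≤ evalBool p y ∧ evalBool p y ≤ 1) → 0 < ε → ε ≤ boolVariance p →
        ∃ i : Fin N, C₁ * (ε / d) ^ c ≤ influence i p := by
  intro N d p ε hd hp hb hε hv
  obtain ⟨i, hi⟩ := H N d p ε hd hp hb hε hv
  exact ⟨i, (mul_le_mul_of_nonneg_right hle (by positivity)).trans hi⟩

/-- **Claim (apx) from machines for DYADIC constants only** — the form of the obligation a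
machine construction can meet: all thresholds of `simTreeOn c 2^{-k} F x` (variance threshold
`ε²δ/2`, influence threshold `2^{-k} (θ/d)^c`, budget, output threshold `1/2`, with `ε = 1/10`,
`δ = 1/(2n³)`) are then RATIONAL, so its tests are exact sign tests on the algebraic quantities
`Var`, `Inf_i`, `E[p_ρ]` of a Clifford+T acceptance polynomial (cf. `StateVectorDP.posSqrtTwoTest`),
and the queried variable is the least qualifying index (`ClassicalSimulation.pickVar`). If for
all `c k : ℕ` for which the body of Conjecture 6 holds with `C₀ = 2^{-k}`, and under `P = P^{#P}`,
every uniform family has a polynomial-time transcript machine computing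
`A, x ↦ [ (simTreeOn c 2^{-k} F x).eval (oracleBits F x A) ≥ 1/2 ]`, then claim (apx) of the
proof of Thm. 23 holds (the real constant `C₀` of `AAConjecture` is rounded down to a power of
`2`, `aaConjectureBody_mono`). [cite: AaronsonAmbainis2014, Thm. 23 (proof, p. 14)] -/
theorem aaronsonAmbainis2014_thm23_apx_of_dyadicMachines
    (hmach : ∀ (c k : ℕ),
      (∀ (N d : ℕ) (p : MvPolynomial (Fin N) ℝ) (ε : ℝ), 1 ≤ d → p.totalDegree ≤ d →
        (∀ y, 0 ≤ evalBool p y ∧ evalBool p y ≤ 1) → 0 < ε → ε ≤ boolVariance p →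
          ∃ i : Fin N, (2 : ℝ)⁻¹ ^ k * (ε / d) ^ c ≤ influence i p) →
      P = PSharpP → ∀ F : QCircuitFamily cliffordT, F.IsUniform →
        ∃ (C : OracleAlg Bool) (q : Polynomial ℕ), C.IsPolyTime encodingBoolBool ∧
          (∀ (A : Language Bool) (x : List Bool),
            ∀ y ∈ C.queries (Oracle.ofLanguage A) (q.eval x.length) x, y.length ≤ q.eval x.length) ∧
          ∀ (A : Language Bool) (x : List Bool), 1 ≤ x.length →
            C.run (Oracle.ofLanguage A) (q.eval x.length) x =
              some (decide (1 / 2 ≤ (simTreeOn c ((2 : ℝ)⁻¹ ^ k) F x).eval (oracleBits F x A)))) :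
    AAConjecture → P = PSharpP →
      ∀ F : QCircuitFamily cliffordT, F.IsUniform →
        ∃ (C : OracleAlg Bool) (q : Polynomial ℕ), C.IsPolyTime encodingBoolBool ∧
          (∀ (A : Language Bool) (x : List Bool),
            ∀ y ∈ C.queries (Oracle.ofLanguage A) (q.eval x.length) x, y.length ≤ q.eval x.length) ∧
          ∀ x : List Bool, 1 ≤ x.length →
            randomOracleMeasure {A : Set (List Bool) |
                (2 / 3 ≤ F.acceptProbOn A x ∧
                    C.run (Oracle.ofLanguage A) (q.eval x.length) x ≠ some true) ∨
                (F.acceptProbOn A x ≤ 1 / 3 ∧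
                    C.run (Oracle.ofLanguage A) (q.eval x.length) x ≠ some false)}
              < ENNReal.ofReal (1 / (x.length : ℝ) ^ 3) := by
  intro hAA hP F hF
  obtain ⟨c, C₀, hC₀, H⟩ := hAA
  -- round the constant down to a power of `2`
  obtain ⟨k, hk⟩ := exists_pow_lt_of_lt_one hC₀ (by norm_num : (2 : ℝ)⁻¹ < 1)
  have H' := aaConjectureBody_mono hk.le H
  have hC₁ : (0 : ℝ) < (2 : ℝ)⁻¹ ^ k := by positivity
  obtain ⟨C, q, hpoly, hq, hrun⟩ := hmach c k H' hP F hF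
  refine ⟨C, q, hpoly, hq, fun x hn => ?_⟩
  have hev := measure_simTreeOn_threshold_lt (c := c) (C₀ := (2 : ℝ)⁻¹ ^ k) F x hC₁ H'
    cliffordT_isUnitary_holds hn
  refine lt_of_le_of_lt (measure_mono fun A hA => ?_) hev
  simp only [Set.mem_setOf_eq] at hA ⊢
  rw [hrun A x hn] at hA
  simpa only [ne_eq, Option.some.injEq] using hA

/-- "Under the assumption `P = P^{#P}`, the entire counting hierarchy collapses to `P`"
(`PP ⊆ P^{#P} = P`, then Bürgisser's Lemma 2.5 / Torán). [cite: AaronsonAmbainis2014, proof of Thm. 23 (p. 14)] -/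
theorem CH_eq_P_of_P_eq_PSharpP (h : P = PSharpP) : CH = P :=
  CH_eq_P_of_PP_eq_P (Set.Subset.antisymm (fun _ hL => h.symm ▸ PP_subset_PSharpP_holds hL)
    (P_subset_CkP 1))

end Literature.Computability.QuantumComplexity

end
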